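import Mathlib.Analysis.Complex.LocallyUniformLimit
import Mathlib.Topology.MetricSpace.Algebra
import Literature.NumberTheory.EllipticCurves.TateSeriesFormal
import Literature.NumberTheory.EllipticCurves.KleinJCuspExpansion
import Literature.NumberTheory.EllipticCurves.ModularCurveKleinJ
import HarnessLib

/-!
# The `q`-expansions of `E₄`, `Δ` and `q·j` over `ℂ` are the integer series `formalE4`,
# `X·formalDeltaUnit` and `formalXJ` (Cox, *Primes of the form x² + ny²*, Thm. 11.8)

Topic `NumberTheory/EllipticCurves` (level-one modular forms); everything in this file is
**proved** (no new definitions).  It is the archimedean companion of `TateSeriesFormal.lean`,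
which defines the INTEGER formal power series

* `formalE4 = 1 + 240 Σ σ₃(n) qⁿ`, `formalDeltaUnit = ∏_{n ≥ 1} (1 − qⁿ)²⁴` and
  `formalXJ = formalE4³ · formalDeltaUnit⁻¹ = 1 + 744 q + 196884 q² + ⋯ ∈ ℤ⟦q⟧`

and evaluates them in complete *ultrametric* fields; its docstring lists "the identification with
the `q`-expansions of Mathlib's complex modular forms `E₄`, `Δ` (archimedean growth of
coefficients)" as not done.  This file does it, for Mathlib's `q`-expansion
`UpperHalfPlane.qExpansion 1` (Taylor series of the cusp function in `q = e^{2πiτ}`) and for the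
values on `ℍ`:

* `qExpansion_E₄ : qExpansion 1 E₄ = formalE4` (from Mathlib's
  `EisensteinSeries.q_expansion_bernoulli` via `E₄_eq_tsum` of `KleinJCuspExpansion.lean`, and
  `ModularFormClass.qExpansion_coeff_unique`); `hasSum_formalE4`.
* `hasSum_formalDeltaUnit : ∏_{n ≥ 1} (1 − qⁿ)²⁴ = Σ dₙ qⁿ` on the unit disc with
  `d = formalDeltaUnit` — the Taylor coefficients of the infinite product are computed as limits
  of those of the truncated products `∏_{n<N} (1 − q^{n+1})²⁴` (which converge locally uniformly,
  Mathlib `ModularForm.multipliableLocallyUniformlyOn_one_sub_pow`, hence so do all derivatives,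
  `TendstoLocallyUniformlyOn.deriv`), and these stabilise at the coefficients of
  `deltaFactorProd N` (`coeff_formalDeltaUnit` of `TateSeriesFormal.lean`);
  `iteratedDeriv_tprod_one_sub_pow_pow_zero`.
* `qExpansion_discriminant : qExpansion 1 Δ = X · formalDeltaUnit` (with Mathlib's product formula
  `ModularForm.discriminant_eq_q_prod`, `Δ = q ∏ (1 − qⁿ)²⁴`); `hasSum_X_mul_formalDeltaUnit`.
* `qExpansion_qParam_mul_kleinJ : qExpansion 1 (q·j) = formalXJ` for Klein's invariant
  `kleinJ = E₄³/Δ` (`ModularCurveKleinJ.lean`): `τ ↦ q(τ) j(τ)` is `1`-periodic, holomorphic and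
  bounded at `i∞` (`= E₄³/∏(1 − qⁿ)²⁴ → 1`), so Mathlib's `hasSum_qExpansion` applies, and
  `qExpansion_mul` turns `(q j)·Δ = q·E₄³` into `F · X · formalDeltaUnit = X · formalE4³` in `ℂ⟦X⟧`.
* **`hasSum_formalXJ : q(τ) j(τ) = Σₙ cₙ q(τ)ⁿ` for every `τ ∈ ℍ`, `c = formalXJ ∈ ℤ⟦q⟧`** — i.e.
  Cox, Thm. 11.8: `j(τ) = 1/q + Σ_{n ≥ 0} cₙ qⁿ` with `cₙ ∈ ℤ` (`kleinJ_eq_tsum`), together with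
  absolute convergence on the unit disc (`summable_norm_formalXJ_mul_pow`).

Also proved, for reuse: the elementary `q`-expansion principle `qSeries_coeff_unique(_of_upperHalfPlane)`
(two `q`-series with the same sum on the punctured disc, resp. on `ℍ` in `q = e^{2πiτ/h}`, have the
same coefficients) and the generic lemmas `TendstoLocallyUniformlyOn.pow_of_continuousOn`,
`TendstoLocallyUniformlyOn.iteratedDeriv_of_differentiableOn`, `iteratedDeriv_polynomial_eval(_zero)`.

These are the inputs of the modular equation `Φ_p(X, j)` and Kronecker's congruence (Cox §11.C,
Thm. 11.18), for which the integrality of the `cₙ` is the whole point.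

## Mathlib / tree search

Mathlib (pin of the tree, Lean `v4.32.0`) has `qExpansion`, `hasSum_qExpansion`, `qExpansion_mul`,
`qExpansion_coeff_unique`, the `E_k` expansions and `Δ = q∏(1 − qⁿ)²⁴`, but states no coefficient of
`Δ` beyond `discriminant_qExpansion_coeff_one` and has no `j`; the tree has `formalXJ` with
`coeff_zero_formalXJ = 1`, `coeff_one_formalXJ = 744` and the ultrametric evaluation only
(`lean search` for `qExpansion_discriminant`, `hasSum_formalXJ`, `196884`: nothing archimedean).

## References

* D. A. Cox, *Primes of the form x² + ny²*, 2nd ed., Wiley 2013, §11.A Thm. 11.8 (`j(τ) = 1/q +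
  744 + Σ cₙqⁿ`, `cₙ ∈ ℤ`; proof referred to Apostol and Lang) and §11.C (its use). [Cox2013]
* J.-P. Serre, *A Course in Arithmetic*, GTM 7, Springer 1973, VII §3.3 Remark and §4.4
  (`Δ = q∏(1 − qⁿ)²⁴`, `j = 1/q + 744 + ⋯` with integer coefficients).
-/

noncomputable section

open Filter Topology Complex PowerSeries
open UpperHalfPlane hiding I
open scoped Real MatrixGroups CongruenceSubgroup Manifold

namespace Literature.NumberTheory.EllipticCurves

open Literature.NumberTheory.EllipticCurves.ModularForms

/-! ### Uniqueness of `q`-series coefficients on the punctured disc -/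

/-- A power series `Σ dₙ qⁿ` that sums to `0` at every point of the punctured unit disc has all
coefficients zero. [folklore] -/
theorem eq_zero_of_hasSum_punctured {d : ℕ → ℂ}
    (h : ∀ q : ℂ, q ≠ 0 → ‖q‖ < 1 → HasSum (fun n ↦ d n * q ^ n) 0) : d = 0 := by
  -- the formal multilinear series with coefficients `d`
  set P : FormalMultilinearSeries ℂ ℂ ℂ := .ofScalars ℂ d with hP
  have hrad : 1 ≤ P.radius := by
    refine le_of_forall_lt_imp_le_of_dense fun r hr ↦ ?_
    lift r to NNReal using hr.ne_top
    rcases eq_or_ne r 0 with rfl | hr0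
    · simp
    have hr1 : ‖((r : ℝ) : ℂ)‖ < 1 := by simpa using hr
    have hsum := (h (r : ℂ) (by exact_mod_cast hr0) hr1).summable
    refine P.le_radius_of_tendsto (l := 0) ?_
    have := hsum.tendsto_atTop_zero.norm
    simp only [norm_zero] at this
    refine this.congr fun n ↦ ?_
    rw [hP, norm_mul, norm_pow, Complex.norm_real, NNReal.norm_eq,
      FormalMultilinearSeries.ofScalars_norm]
  have hball : HasFPowerSeriesOnBall P.sum P 0 1 :=
    (P.hasFPowerSeriesOnBall (lt_of_lt_of_le zero_lt_one hrad)).mono zero_lt_one hrad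
  -- `P.sum` vanishes on the punctured disc
  have hsum_eq : ∀ q : ℂ, q ≠ 0 → ‖q‖ < 1 → P.sum q = 0 := by
    intro q hq0 hq1
    have h1 : P.sum q = ∑' n, d n * q ^ n := by
      rw [hP, show (FormalMultilinearSeries.ofScalars ℂ d).sum q =
        FormalMultilinearSeries.ofScalarsSum d q from rfl, FormalMultilinearSeries.ofScalars_sum_eq]
      simp [smul_eq_mul]
    rw [h1, (h q hq0 hq1).tsum_eq]
  -- hence on the whole disc, by continuity at `0`
  have hzero : ∀ q ∈ Metric.eball (0 : ℂ) 1, P.sum q = 0 := by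
    intro q hq
    have hq1 : ‖q‖ < 1 := by
      rw [← ENNReal.coe_one, Metric.eball_coe, NNReal.coe_one, mem_ball_zero_iff] at hq
      exact hq
    rcases eq_or_ne q 0 with rfl | hq0
    · have hcont : ContinuousAt P.sum 0 :=
        hball.continuousOn.continuousAt (Metric.eball_mem_nhds _ one_pos)
      refine tendsto_nhds_unique
        (hcont.tendsto.mono_left (nhdsWithin_le_nhds (s := ({(0 : ℂ)}ᶜ : Set ℂ)))) ?_
      refine (tendsto_const_nhds (x := (0 : ℂ)) (f := 𝓝[≠] (0 : ℂ))).congr' ?_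
      filter_upwards [self_mem_nhdsWithin,
        mem_nhdsWithin_of_mem_nhds (Metric.ball_mem_nhds (0 : ℂ) one_pos)] with w hw hw1
      exact (hsum_eq w hw (by simpa using hw1)).symm
    · exact hsum_eq q hq0 hq1
  have hP0 : P = 0 := by
    have h0 : HasFPowerSeriesOnBall (fun _ : ℂ ↦ (0 : ℂ)) P 0 1 := hball.congr hzero
    have h0' : HasFPowerSeriesOnBall (fun _ : ℂ ↦ (0 : ℂ)) (0 : FormalMultilinearSeries ℂ ℂ ℂ) 0 ⊤ := by
      simpa using (hasFPowerSeriesOnBall_const (𝕜 := ℂ) (E := ℂ) (c := (0 : ℂ)) (e := 0))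
    exact h0.hasFPowerSeriesAt.eq_formalMultilinearSeries h0'.hasFPowerSeriesAt
  rw [hP] at hP0
  exact (FormalMultilinearSeries.ofScalars_series_eq_zero (E := ℂ)).mp hP0

/-- Two `q`-series `Σ cₙ qⁿ`, `Σ c'ₙ qⁿ` with the same sum at every point of the punctured unit disc
have the same coefficients. [folklore] -/
theorem qSeries_coeff_unique {c c' : ℕ → ℂ}
    (h : ∀ q : ℂ, q ≠ 0 → ‖q‖ < 1 →
      ∃ a : ℂ, HasSum (fun n ↦ c n * q ^ n) a ∧ HasSum (fun n ↦ c' n * q ^ n) a) : c = c' := by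
  have := eq_zero_of_hasSum_punctured (d := fun n ↦ c n - c' n) fun q hq0 hq1 ↦ by
    obtain ⟨a, ha, ha'⟩ := h q hq0 hq1
    simpa [sub_mul] using ha.sub ha'
  funext n
  exact sub_eq_zero.mp (congr_fun this n)

/-- Every point of the punctured unit disc is `q(τ) = e^{2πiτ/h}` for some `τ ∈ ℍ` (`h > 0`).
[folklore] -/
theorem exists_qParam_eq {h : ℝ} (hh : 0 < h) {q : ℂ} (hq0 : q ≠ 0) (hq1 : ‖q‖ < 1) :
    ∃ τ : ℍ, Function.Periodic.qParam h τ = q :=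
  ⟨⟨Function.Periodic.invQParam h q, Function.Periodic.im_invQParam_pos_of_norm_lt_one hh hq1 hq0⟩,
    by simpa using Function.Periodic.qParam_right_inv hh.ne' hq0⟩

/-- `q`-series in `q(τ) = e^{2πiτ/h}` representing the same function on `ℍ` have the same
coefficients (the elementary `q`-expansion principle). [folklore] -/
theorem qSeries_coeff_unique_of_upperHalfPlane {h : ℝ} (hh : 0 < h) {c c' : ℕ → ℂ} {f : ℍ → ℂ}
    (hc : ∀ τ : ℍ, HasSum (fun n ↦ c n * Function.Periodic.qParam h τ ^ n) (f τ))
    (hc' : ∀ τ : ℍ, HasSum (fun n ↦ c' n * Function.Periodic.qParam h τ ^ n) (f τ)) : c = c' := by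
  refine qSeries_coeff_unique fun q hq0 hq1 ↦ ?_
  obtain ⟨τ, rfl⟩ := exists_qParam_eq hh hq0 hq1
  exact ⟨f τ, hc τ, hc' τ⟩

/-! ### `E₄ = 1 + 240 Σ σ₃(n) qⁿ`: the `q`-expansion of `E₄` is `formalE4` -/

/-- `E₄(τ) = Σₙ aₙ qⁿ` with `aₙ` the coefficients of the integer series `formalE4`
(`a₀ = 1`, `aₙ = 240σ₃(n)`). [cite: Cox2013, §11.A Thm. 11.8 (proof references)] -/
theorem hasSum_formalE4 (τ : ℍ) :
    HasSum (fun n ↦ ((coeff n formalE4 : ℤ) : ℂ) * Function.Periodic.qParam 1 τ ^ n)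
      (ModularForm.E₄ τ) := by
  set q := Function.Periodic.qParam 1 (τ : ℂ) with hq
  have hs := summable_sigma_mul_qParam_pow τ
  have htail : HasSum (fun n : ℕ ↦ ((coeff (n + 1) formalE4 : ℤ) : ℂ) * q ^ (n + 1))
      (ModularForm.E₄ τ - 1) := by
    have h1 : HasSum (fun n : ℕ ↦ (ArithmeticFunction.sigma 3 (n + 1) : ℂ) * q ^ (n + 1))
        (∑' n : ℕ, (ArithmeticFunction.sigma 3 (n + 1) : ℂ) * q ^ (n + 1)) :=
      ((summable_nat_add_iff 1).mpr hs).hasSum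
    have h2 := h1.mul_left 240
    rw [E₄_eq_tsum τ, add_sub_cancel_left]
    refine h2.congr_fun fun n ↦ ?_
    simp only [coeff_formalE4, Nat.succ_ne_zero, ↓reduceIte, Int.cast_mul, Int.cast_ofNat,
      Int.cast_natCast]
    ring
  refine (hasSum_nat_add_iff' (f := fun n ↦ ((coeff n formalE4 : ℤ) : ℂ) * q ^ n) 1).mp ?_
  simpa using htail

/-- **The `q`-expansion of `E₄` is the integer series `formalE4 = 1 + 240 Σ σ₃(n)qⁿ`.**
[cite: Cox2013, §11.A Thm. 11.8 (proof references)] -/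
theorem qExpansion_E₄ :
    qExpansion 1 ModularForm.E₄ = formalE4.map (Int.castRingHom ℂ) := by
  refine PowerSeries.ext fun n ↦ ?_
  have h := ModularFormClass.qExpansion_coeff_unique one_pos one_mem_strictPeriods_SL
    (f := ModularForm.E₄) (c := fun n ↦ ((coeff n formalE4 : ℤ) : ℂ))
    (fun τ ↦ by simpa only [smul_eq_mul] using hasSum_formalE4 τ) n
  rw [PowerSeries.coeff_map, Int.coe_castRingHom, ← h]

/-! ### Locally uniform limits: iterated derivatives and powers -/

/-- Reindexing a locally uniform limit along a map of filters. [folklore] -/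
theorem _root_.TendstoLocallyUniformlyOn.comp_tendsto_index {α β ι κ : Type*} [TopologicalSpace α]
    [UniformSpace β] {F : ι → α → β} {f : α → β} {s : Set α} {p : Filter ι} {l : Filter κ}
    (h : TendstoLocallyUniformlyOn F f p s) {u : κ → ι} (hu : Tendsto u l p) :
    TendstoLocallyUniformlyOn (F ∘ u) f l s := fun v hv x hx ↦ by
  obtain ⟨t, ht, H⟩ := h v hv x hx
  exact ⟨t, ht, hu.eventually H⟩

/-- Powers of a locally uniformly convergent sequence of complex functions with continuous limit
converge locally uniformly. [folklore] -/
theorem _root_.TendstoLocallyUniformlyOn.pow_of_continuousOn {α ι : Type*} [TopologicalSpace α]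
    {F : ι → α → ℂ} {f : α → ℂ} {s : Set α} {l : Filter ι}
    (h : TendstoLocallyUniformlyOn F f l s) (hf : ContinuousOn f s) (k : ℕ) :
    TendstoLocallyUniformlyOn (fun n x ↦ F n x ^ k) (fun x ↦ f x ^ k) l s := by
  induction k with
  | zero =>
    intro v hv x _
    refine ⟨Set.univ, Filter.univ_mem, Filter.Eventually.of_forall fun n y _ ↦ ?_⟩
    simpa using refl_mem_uniformity hv
  | succ k ih =>
    simp_rw [pow_succ]
    exact ih.fun_mul₀ h (hf.pow k) hf

/-- Iterated derivatives of a locally uniformly convergent sequence of holomorphic functions on an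
open set converge locally uniformly (Weierstrass). [folklore] -/
theorem _root_.TendstoLocallyUniformlyOn.iteratedDeriv_of_differentiableOn {ι : Type*}
    {F : ι → ℂ → ℂ} {f : ℂ → ℂ} {U : Set ℂ} {l : Filter ι} [l.NeBot]
    (h : TendstoLocallyUniformlyOn F f l U) (hF : ∀ n, DifferentiableOn ℂ (F n) U)
    (hU : IsOpen U) (k : ℕ) :
    TendstoLocallyUniformlyOn (fun n ↦ iteratedDeriv k (F n)) (iteratedDeriv k f) l U := by
  induction k with
  | zero => simpa using h
  | succ k ih =>
    have hdiff : ∀ᶠ n in l, DifferentiableOn ℂ (iteratedDeriv k (F n)) U :=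
      Filter.Eventually.of_forall fun n ↦ by
        rw [iteratedDeriv_eq_iterate]
        exact (((hF n).analyticOnNhd hU).iterated_deriv k).differentiableOn
    simpa [iteratedDeriv_succ, Function.comp_def] using ih.deriv hdiff hU

/-- The `k`-th derivative of a polynomial function is the polynomial function of the `k`-th formal
derivative. [folklore] -/
theorem iteratedDeriv_polynomial_eval (P : Polynomial ℂ) (k : ℕ) :
    iteratedDeriv k (fun x ↦ P.eval x) = fun x ↦ (Polynomial.derivative^[k] P).eval x := by
  induction k with
  | zero => simp
  | succ k ih =>
    rw [iteratedDeriv_succ, ih, Function.iterate_succ_apply']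
    funext x
    exact Polynomial.deriv _

/-- `(d/dx)^k P (0) = k! · (coefficient of x^k)`. [folklore] -/
theorem iteratedDeriv_polynomial_eval_zero (P : Polynomial ℂ) (k : ℕ) :
    iteratedDeriv k (fun x ↦ P.eval x) 0 = (k.factorial : ℂ) * P.coeff k := by
  rw [iteratedDeriv_polynomial_eval]
  show (Polynomial.derivative^[k] P).eval 0 = _
  rw [← Polynomial.coeff_zero_eq_eval_zero, Polynomial.coeff_iterate_derivative, zero_add,
    Nat.descFactorial_self, nsmul_eq_mul]

/-! ### `Δ/q = ∏ (1 − qⁿ)²⁴ = Σ dₙ qⁿ` with `d = formalDeltaUnit ∈ ℤ⟦q⟧` -/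

/-- The truncated products `∏_{n<N} (1 − q^{n+1})²⁴` converge to `∏_{n ≥ 1} (1 − qⁿ)²⁴` locally
uniformly on the unit disc. [folklore] -/
theorem tendstoLocallyUniformlyOn_prod_one_sub_pow_pow :
    TendstoLocallyUniformlyOn (fun N q ↦ ∏ n ∈ Finset.range N, (1 - q ^ (n + 1)) ^ 24)
      (fun q : ℂ ↦ ∏' n, (1 - q ^ (n + 1)) ^ 24) atTop (Metric.ball 0 1) := by
  have h1 : TendstoLocallyUniformlyOn (fun N q ↦ ∏ n ∈ Finset.range N, (1 - q ^ (n + 1)))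
      (fun q : ℂ ↦ ∏' n, (1 - q ^ (n + 1))) atTop (Metric.ball 0 1) := by
    have := (hasProdLocallyUniformlyOn_iff_tendstoLocallyUniformlyOn.mp
      ModularForm.multipliableLocallyUniformlyOn_one_sub_pow.hasProdLocallyUniformlyOn)
    exact this.comp_tendsto_index tendsto_finset_range
  have h2 := h1.pow_of_continuousOn ModularForm.differentiableOn_tprod_one_sub_pow.continuousOn 24
  refine (h2.congr fun N q _ ↦ ?_).congr_right fun q hq ↦ ?_
  · simp [Finset.prod_pow]
  · exact ((ModularForm.multipliable_one_sub_pow (by simpa using hq)).tprod_pow 24).symm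

/-- The truncated product `∏_{n<N} (1 − q^{n+1})²⁴` as the polynomial function of the image of
`deltaFactorProd N`. [folklore] -/
theorem prod_one_sub_pow_pow_eq_eval (N : ℕ) (q : ℂ) :
    ∏ n ∈ Finset.range N, (1 - q ^ (n + 1)) ^ 24 =
      (∏ n ∈ Finset.range N, (1 - Polynomial.X ^ (n + 1)) ^ 24 : Polynomial ℂ).eval q := by
  simp [Polynomial.eval_prod]

/-- The coefficients of the complex polynomial `∏_{n<N} (1 − X^{n+1})²⁴` are those of the integer
power series `deltaFactorProd N`. [folklore] -/
theorem coeff_prod_one_sub_X_pow_pow (N k : ℕ) :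
    (∏ n ∈ Finset.range N, (1 - Polynomial.X ^ (n + 1)) ^ 24 : Polynomial ℂ).coeff k =
      ((coeff k (deltaFactorProd N) : ℤ) : ℂ) := by
  have h1 : ((∏ n ∈ Finset.range N, (1 - Polynomial.X ^ (n + 1)) ^ 24 : Polynomial ℂ) :
      PowerSeries ℂ) = (deltaFactorProd N).map (Int.castRingHom ℂ) := by
    rw [deltaFactorProd, map_prod, ← Polynomial.coeToPowerSeries.ringHom_apply, map_prod]
    refine Finset.prod_congr rfl fun n _ ↦ ?_
    simp [Polynomial.coeToPowerSeries.ringHom_apply, Polynomial.coe_sub, Polynomial.coe_pow]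
  rw [← Polynomial.coeff_coe, h1, coeff_map, Int.coe_castRingHom]

/-- **The Taylor coefficients of `∏ (1 − qⁿ)²⁴` at `q = 0` are the integers `formalDeltaUnit`**:
`(d/dq)^k ∏ (1 − qⁿ)²⁴ |_{q=0} = k! · dₖ`. [cite: Cox2013, §11.A Thm. 11.8 (proof references)] -/
theorem iteratedDeriv_tprod_one_sub_pow_pow_zero (k : ℕ) :
    iteratedDeriv k (fun q : ℂ ↦ ∏' n, (1 - q ^ (n + 1)) ^ 24) 0 =
      (k.factorial : ℂ) * ((coeff k formalDeltaUnit : ℤ) : ℂ) := by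
  have hlim := ((tendstoLocallyUniformlyOn_prod_one_sub_pow_pow.iteratedDeriv_of_differentiableOn
    (fun N ↦ ?_) Metric.isOpen_ball k).tendsto_at (Metric.mem_ball_self one_pos))
  · -- the sequence is eventually constant `= k! d_k`
    refine tendsto_nhds_unique hlim (tendsto_const_nhds.congr' ?_)
    filter_upwards [Filter.eventually_ge_atTop k] with N hN
    have : (fun q : ℂ ↦ ∏ n ∈ Finset.range N, (1 - q ^ (n + 1)) ^ 24) =
        fun q ↦ (∏ n ∈ Finset.range N, (1 - Polynomial.X ^ (n + 1)) ^ 24 : Polynomial ℂ).eval q :=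
      funext (prod_one_sub_pow_pow_eq_eval N)
    rw [this, iteratedDeriv_polynomial_eval_zero, coeff_prod_one_sub_X_pow_pow,
      ← coeff_formalDeltaUnit hN]
  · have : (fun q : ℂ ↦ ∏ n ∈ Finset.range N, (1 - q ^ (n + 1)) ^ 24) =
        fun q ↦ (∏ n ∈ Finset.range N, (1 - Polynomial.X ^ (n + 1)) ^ 24 : Polynomial ℂ).eval q :=
      funext (prod_one_sub_pow_pow_eq_eval N)
    rw [this]
    exact (Polynomial.differentiable _).differentiableOn

/-- **`∏_{n ≥ 1} (1 − qⁿ)²⁴ = Σ dₙ qⁿ` on the unit disc, `d = formalDeltaUnit ∈ ℤ⟦q⟧`** (the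
`q`-expansion of `Δ/q` has integer coefficients; Cox, Thm. 11.8, references).
[cite: Cox2013, §11.A Thm. 11.8 (proof references)] -/
theorem hasSum_formalDeltaUnit {q : ℂ} (hq : ‖q‖ < 1) :
    HasSum (fun n ↦ ((coeff n formalDeltaUnit : ℤ) : ℂ) * q ^ n) (∏' n, (1 - q ^ (n + 1)) ^ 24) := by
  have h := Complex.hasSum_taylorSeries_on_ball (ModularForm.differentiableOn_tprod_one_sub_pow_pow 24)
    (mem_ball_zero_iff.mpr hq)
  refine h.congr_fun fun n ↦ ?_
  rw [iteratedDeriv_tprod_one_sub_pow_pow_zero, sub_zero, smul_eq_mul, smul_eq_mul]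
  have : (n.factorial : ℂ) ≠ 0 := by exact_mod_cast n.factorial_ne_zero
  field_simp

/-! ### The `q`-expansion of `Δ` is `X · formalDeltaUnit ∈ ℤ⟦X⟧` -/

/-- `Δ(τ) = Σₙ tₙ qⁿ` where `t = X · formalDeltaUnit` is the integer series `q ∏ (1 − qⁿ)²⁴`
(`t₀ = 0`, `t₁ = 1`, `t₂ = −24`, …). [cite: Cox2013, §11.A Thm. 11.8 (proof references)] -/
theorem hasSum_X_mul_formalDeltaUnit (τ : ℍ) :
    HasSum (fun n ↦ ((coeff n (X * formalDeltaUnit) : ℤ) : ℂ) * Function.Periodic.qParam 1 τ ^ n)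
      (ModularForm.discriminant τ) := by
  set q := Function.Periodic.qParam 1 (τ : ℂ) with hq
  have hq1 : ‖q‖ < 1 := norm_qParam_one_lt_one τ
  have hP := (hasSum_formalDeltaUnit hq1).mul_left q
  rw [ModularForm.discriminant_eq_q_prod τ]
  refine (hasSum_nat_add_iff' (f := fun n ↦ ((coeff n (X * formalDeltaUnit) : ℤ) : ℂ) * q ^ n)
    1).mp ?_
  simp only [Finset.range_one, Finset.sum_singleton, coeff_zero_X_mul, Int.cast_zero, zero_mul,
    sub_zero, coeff_succ_X_mul]
  refine hP.congr_fun fun n ↦ ?_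
  simp only [hq]
  ring

/-- **The `q`-expansion of the modular discriminant has integer coefficients**: it is the image of
`X · formalDeltaUnit = q ∏ (1 − qⁿ)²⁴ ∈ ℤ⟦q⟧`. [cite: Cox2013, §11.A Thm. 11.8 (proof references)] -/
theorem qExpansion_discriminant :
    qExpansion 1 ModularForm.discriminant = (X * formalDeltaUnit).map (Int.castRingHom ℂ) := by
  refine PowerSeries.ext fun n ↦ ?_
  have h := ModularFormClass.qExpansion_coeff_unique one_pos one_mem_strictPeriods_SL
    (f := CuspForm.discriminant) (c := fun n ↦ ((coeff n (X * formalDeltaUnit) : ℤ) : ℂ))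
    (fun τ ↦ by
      simpa only [smul_eq_mul, CuspForm.coe_discriminant] using hasSum_X_mul_formalDeltaUnit τ) n
  rw [PowerSeries.coeff_map, Int.coe_castRingHom, ← CuspForm.coe_discriminant, ← h]

/-! ### `q · j(τ) = Σ cₙ qⁿ` with `c = formalXJ ∈ ℤ⟦q⟧` -/

/-- `q(τ) j(τ) = E₄(τ)³ / ∏ (1 − qⁿ)²⁴`. [folklore] -/
theorem qParam_mul_kleinJ_eq (τ : ℍ) :
    Function.Periodic.qParam 1 τ * kleinJ τ =
      ModularForm.E₄ τ ^ 3 / ∏' n, (1 - ModularForm.eta_q n τ) ^ 24 := by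
  rw [kleinJ, ModularForm.discriminant_eq_q_prod, mul_div_assoc',
    mul_div_mul_left _ _ (Function.Periodic.qParam_ne_zero _)]

/-- `τ ↦ q(τ) j(τ)` is holomorphic on `ℍ`. [folklore] -/
theorem mdifferentiable_qParam_mul_kleinJ :
    MDiff (fun τ : ℍ ↦ Function.Periodic.qParam 1 τ * kleinJ τ) := by
  rw [UpperHalfPlane.mdifferentiable_iff]
  have hq : DifferentiableOn ℂ (Function.Periodic.qParam 1) {z : ℂ | 0 < z.im} := by
    intro z _
    apply DifferentiableAt.differentiableWithinAt
    unfold Function.Periodic.qParam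
    fun_prop
  refine (hq.mul differentiableOn_kleinJ).congr fun z hz ↦ ?_
  simp [Function.comp_apply, ofComplex_apply_of_im_pos hz]

/-- `τ ↦ q(τ) j(τ)` is `1`-periodic. [folklore] -/
theorem periodic_qParam_mul_kleinJ :
    Function.Periodic ((fun τ : ℍ ↦ Function.Periodic.qParam 1 τ * kleinJ τ) ∘ ofComplex) 1 := by
  intro z
  by_cases hz : 0 < z.im
  · have hz' : 0 < (z + 1).im := by simpa using hz
    simp only [Function.comp_apply, ofComplex_apply_of_im_pos hz, ofComplex_apply_of_im_pos hz']
    have hT : ModularGroup.T • (⟨z, hz⟩ : ℍ) = ⟨z + 1, hz'⟩ := by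
      apply UpperHalfPlane.ext
      rw [UpperHalfPlane.modular_T_smul, UpperHalfPlane.coe_vadd]
      simp [add_comm]
    rw [← hT, kleinJ_smul]
    congr 1
    simp only [Function.Periodic.qParam, Complex.ofReal_one, div_one,
      mul_add, mul_one, Complex.exp_add, Complex.exp_two_pi_mul_I]
  · have h1 : z.im ≤ 0 := not_lt.mp hz
    have h2 : (z + 1).im ≤ 0 := by simpa using h1
    simp only [Function.comp_apply, ofComplex_apply_of_im_nonpos h1, ofComplex_apply_of_im_nonpos h2]

/-- `τ ↦ q(τ) j(τ)` is bounded at `i∞` (indeed it tends to `1`). [folklore] -/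
theorem isBoundedAtImInfty_qParam_mul_kleinJ :
    IsBoundedAtImInfty (fun τ : ℍ ↦ Function.Periodic.qParam 1 τ * kleinJ τ) := by
  have hE : Tendsto (fun τ : ℍ ↦ ModularForm.E₄ τ ^ 3) atImInfty (𝓝 1) := by
    have h4 : Tendsto (fun τ : ℍ ↦ ModularForm.E₄ τ) atImInfty (𝓝 1) := by
      have han := ModularFormClass.analyticAt_cuspFunction_zero ModularForm.E₄ one_pos
        one_mem_strictPeriods_SL
      have hper := SlashInvariantFormClass.periodic_comp_ofComplex ModularForm.E₄
        one_mem_strictPeriods_SL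
      have h := han.continuousAt.tendsto.comp (qParam_tendsto_atImInfty one_pos)
      have hval : cuspFunction 1 ModularForm.E₄ 0 = 1 := by
        rw [UpperHalfPlane.cuspFunction_apply_zero one_pos han hper,
          ← UpperHalfPlane.qExpansion_coeff_zero one_pos han hper, qExpansion_E₄]
        simp
      rw [hval] at h
      refine h.congr fun τ ↦ ?_
      simp [Function.comp_apply, UpperHalfPlane.eq_cuspFunction τ one_ne_zero hper]
    simpa using h4.pow 3
  have hP := ModularForm.tendsto_atImInfty_tprod_one_sub_eta_q_pow
  have h := hE.div hP one_ne_zero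
  rw [div_one] at h
  have : (fun τ : ℍ ↦ Function.Periodic.qParam 1 τ * kleinJ τ) =
      fun τ ↦ ModularForm.E₄ τ ^ 3 / ∏' n, (1 - ModularForm.eta_q n τ) ^ 24 :=
    funext qParam_mul_kleinJ_eq
  rw [this]
  exact h.isBigO_one ℝ

/-- The cusp function of `τ ↦ q(τ) j(τ)` is analytic at `q = 0`. [folklore] -/
theorem analyticAt_cuspFunction_qParam_mul_kleinJ :
    AnalyticAt ℂ (cuspFunction 1 (fun τ : ℍ ↦ Function.Periodic.qParam 1 τ * kleinJ τ)) 0 :=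
  analyticAt_cuspFunction_zero one_pos periodic_qParam_mul_kleinJ mdifferentiable_qParam_mul_kleinJ
    isBoundedAtImInfty_qParam_mul_kleinJ

/-- `τ ↦ q(τ) = e^{2πiτ}` is `1`-periodic. [folklore] -/
theorem periodic_qParam_one :
    Function.Periodic ((fun τ : ℍ ↦ Function.Periodic.qParam 1 τ) ∘ ofComplex) 1 := by
  intro z
  by_cases hz : 0 < z.im
  · have hz' : 0 < (z + 1).im := by simpa using hz
    simp only [Function.comp_apply, ofComplex_apply_of_im_pos hz, ofComplex_apply_of_im_pos hz',
      UpperHalfPlane.coe_mk, Function.Periodic.qParam, Complex.ofReal_one, div_one, mul_add,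
      mul_one, Complex.exp_add, Complex.exp_two_pi_mul_I]
  · have h1 : z.im ≤ 0 := not_lt.mp hz
    have h2 : (z + 1).im ≤ 0 := by simpa using h1
    simp only [Function.comp_apply, ofComplex_apply_of_im_nonpos h1,
      ofComplex_apply_of_im_nonpos h2]

/-- `τ ↦ q(τ)` is holomorphic on `ℍ`. [folklore] -/
theorem mdifferentiable_qParam_one : MDiff (fun τ : ℍ ↦ Function.Periodic.qParam 1 τ) := by
  rw [UpperHalfPlane.mdifferentiable_iff]
  refine (Function.Periodic.differentiable_qParam (h := 1)).differentiableOn.congr fun z hz ↦ ?_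
  simp [Function.comp_apply, ofComplex_apply_of_im_pos hz]

/-- `q(τ) = Σₙ δ_{n,1} q(τ)ⁿ`. [folklore] -/
theorem hasSum_qParam_one (τ : ℍ) :
    HasSum (fun n ↦ (if n = 1 then (1 : ℂ) else 0) • Function.Periodic.qParam 1 τ ^ n)
      (Function.Periodic.qParam 1 τ) := by
  refine (hasSum_ite_eq 1 (Function.Periodic.qParam 1 (τ : ℂ))).congr_fun fun n ↦ ?_
  by_cases hn : n = 1 <;> simp [hn]

/-- `τ ↦ q(τ)` is bounded at `i∞`. [folklore] -/
theorem isBoundedAtImInfty_qParam_one :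
    IsBoundedAtImInfty (fun τ : ℍ ↦ Function.Periodic.qParam 1 τ) :=
  UpperHalfPlane.isBoundedAtImInfty_of_hasSum_qExpansion one_pos hasSum_qParam_one

/-- The cusp function of `τ ↦ q(τ)` (the identity) is analytic at `0`. [folklore] -/
theorem analyticAt_cuspFunction_qParam_one :
    AnalyticAt ℂ (cuspFunction 1 (fun τ : ℍ ↦ Function.Periodic.qParam 1 τ)) 0 :=
  analyticAt_cuspFunction_zero one_pos periodic_qParam_one mdifferentiable_qParam_one
    isBoundedAtImInfty_qParam_one

/-- The `q`-expansion of the `1`-periodic function `τ ↦ q(τ)` is `X`. [folklore] -/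
theorem qExpansion_qParam : qExpansion 1 (fun τ : ℍ ↦ Function.Periodic.qParam 1 τ) = X := by
  refine PowerSeries.ext fun n ↦ ?_
  have h := UpperHalfPlane.hasFPowerSeriesOnBall_cuspFunction one_pos
    analyticAt_cuspFunction_qParam_one hasSum_qParam_one
  have h' := UpperHalfPlane.hasFPowerSeriesOnBall_cuspFunction one_pos
    analyticAt_cuspFunction_qParam_one (fun τ ↦ hasSum_qExpansion one_pos periodic_qParam_one
      mdifferentiable_qParam_one isBoundedAtImInfty_qParam_one τ)
  have := congr_arg (FormalMultilinearSeries.coeff · n)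
    (h'.hasFPowerSeriesAt.eq_formalMultilinearSeries h.hasFPowerSeriesAt)
  simp only [FormalMultilinearSeries.coeff_ofScalars] at this
  rw [this, coeff_X]

/-- **The `q`-expansion of `q·j` is the integer series `formalXJ = E₄³·(Δ/q)⁻¹ = 1 + 744q + ⋯`**
(Cox, Thm. 11.8: `j(τ) = 1/q + Σ_{n≥0} cₙ qⁿ` with `cₙ ∈ ℤ`). [cite: Cox2013, §11.A Thm. 11.8] -/
theorem qExpansion_qParam_mul_kleinJ :
    qExpansion 1 (fun τ : ℍ ↦ Function.Periodic.qParam 1 τ * kleinJ τ) =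
      formalXJ.map (Int.castRingHom ℂ) := by
  set f : ℍ → ℂ := fun τ ↦ Function.Periodic.qParam 1 τ * kleinJ τ with hf
  set qf : ℍ → ℂ := fun τ ↦ Function.Periodic.qParam 1 τ with hqf
  -- `f · Δ = q · E₄³` as functions on `ℍ`
  have hfun : f * ModularForm.discriminant = qf * ⇑(ModularForm.E₄.pow 3) := by
    funext τ
    simp only [Pi.mul_apply, hf, hqf, ModularForm.coe_pow, Pi.pow_apply]
    rw [mul_assoc, ← E₄_cube_eq_kleinJ_mul]
  -- take `q`-expansions
  have hΔan := ModularFormClass.analyticAt_cuspFunction_zero CuspForm.discriminant one_pos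
    one_mem_strictPeriods_SL
  rw [CuspForm.coe_discriminant] at hΔan
  have hEan := ModularFormClass.analyticAt_cuspFunction_zero (ModularForm.E₄.pow 3) one_pos
    one_mem_strictPeriods_SL
  have hqfan : AnalyticAt ℂ (cuspFunction 1 qf) 0 := analyticAt_cuspFunction_qParam_one
  have h1 := qExpansion_mul analyticAt_cuspFunction_qParam_mul_kleinJ hΔan
  have h2 := qExpansion_mul hqfan hEan
  rw [← hf] at h1
  rw [hfun, h2, hqf, qExpansion_qParam, ModularForm.qExpansion_pow one_pos one_mem_strictPeriods_SL,
    qExpansion_E₄, qExpansion_discriminant] at h1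
  -- `h1 : F · (X·D) = X · A³` in `ℂ⟦X⟧`; cancel `X` and `D`
  have hD : formalDeltaUnit.map (Int.castRingHom ℂ) ≠ 0 := by
    intro h0
    have := congr_arg (coeff 0) h0
    simp [coeff_map] at this
  have hXJ : formalXJ.map (Int.castRingHom ℂ) * formalDeltaUnit.map (Int.castRingHom ℂ) =
      formalE4.map (Int.castRingHom ℂ) ^ 3 := by
    rw [← map_mul, formalXJ, mul_assoc, mul_comm (invOfUnit _ _), formalDeltaUnit_mul_invOfUnit,
      mul_one, map_pow]
  apply mul_right_cancel₀ hD
  rw [hXJ]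
  apply mul_left_cancel₀ (X_ne_zero (R := ℂ))
  rw [h1, map_mul, map_X]
  ring

/-- **`q(τ) j(τ) = Σₙ cₙ q(τ)ⁿ` for every `τ ∈ ℍ`, with `c = formalXJ ∈ ℤ⟦q⟧`** (`c₀ = 1`,
`c₁ = 744`, `c₂ = 196884`, …; Cox, Thm. 11.8). [cite: Cox2013, §11.A Thm. 11.8] -/
theorem hasSum_formalXJ (τ : ℍ) :
    HasSum (fun n ↦ ((coeff n formalXJ : ℤ) : ℂ) * Function.Periodic.qParam 1 τ ^ n)
      (Function.Periodic.qParam 1 τ * kleinJ τ) := by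
  have h := hasSum_qExpansion one_pos periodic_qParam_mul_kleinJ mdifferentiable_qParam_mul_kleinJ
    isBoundedAtImInfty_qParam_mul_kleinJ τ
  rw [qExpansion_qParam_mul_kleinJ] at h
  simpa only [coeff_map, Int.coe_castRingHom, smul_eq_mul] using h

/-- The series `Σ cₙ qⁿ`, `c = formalXJ`, converges absolutely on the open unit disc (its radius of
convergence is `1`). [cite: Cox2013, §11.A Thm. 11.8] -/
theorem summable_norm_formalXJ_mul_pow {q : ℂ} (hq : ‖q‖ < 1) :
    Summable fun n ↦ ‖((coeff n formalXJ : ℤ) : ℂ) * q ^ n‖ := by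
  have h := UpperHalfPlane.hasFPowerSeriesOnBall_cuspFunction one_pos
    analyticAt_cuspFunction_qParam_mul_kleinJ (c := fun n ↦ ((coeff n formalXJ : ℤ) : ℂ))
    (fun τ ↦ by simpa only [smul_eq_mul] using hasSum_formalXJ τ)
  have hr : (‖q‖₊ : ENNReal) <
      (FormalMultilinearSeries.ofScalars ℂ (fun n ↦ ((coeff n formalXJ : ℤ) : ℂ))).radius :=
    lt_of_lt_of_le (by exact_mod_cast hq) h.r_le
  have := FormalMultilinearSeries.summable_norm_mul_pow _ hr
  refine this.congr fun n ↦ ?_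
  rw [FormalMultilinearSeries.ofScalars_norm, norm_mul, norm_pow, coe_nnnorm]

/-- `j(τ) = q⁻¹ Σₙ cₙ qⁿ = 1/q + 744 + 196884 q + ⋯`. [cite: Cox2013, §11.A Thm. 11.8] -/
theorem kleinJ_eq_tsum (τ : ℍ) :
    kleinJ τ = (Function.Periodic.qParam 1 τ)⁻¹ *
      ∑' n, ((coeff n formalXJ : ℤ) : ℂ) * Function.Periodic.qParam 1 τ ^ n := by
  rw [(hasSum_formalXJ τ).tsum_eq, ← mul_assoc, inv_mul_cancel₀ (Function.Periodic.qParam_ne_zero _),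
    one_mul]

end Literature.NumberTheory.EllipticCurves

end
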